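import Summits.Ventures.PercRepro.S3ShadowLayersRLS

/-!
# PercRepro — THE SHADOW LAYERS: MONOTONICITY IN THE GROUND SIZE AND THE KERNEL INSTANCES `p = 9 … 30` (p8, S3)

`proofs/SUBCLAIM-S3-p8.md` §3b. The layer product `L_k(n) = Π_{i<k} (n − F(q+i))/(q+i+1)` is monotone in `n`
(`layerProd_mono`), so one rational inequality `Φ(p, 6) ≤ Σ_k L_k(n₀)` at the least `n₀` closes every cell `(p, d)`
with `p + d ≥ n₀` (`rls_six_of_layers_core_of_le`). Instances (the typed `F u = 44·2^{u−6} − 1`; `n₀` from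
`checks/shadow_instances.py`): `(p, |E| ≥ n₀)` for `p = 9 … 30` with `n₀` = 61 75 88 92 97 102 110 119 131 146 165 178 183
190 199 210 225 243 265 292 325 353 — i.e. the cells `(p, d ≥ n₀ − p)` of the S3 map: `(13, d ≥ 84)`, …, `(20, d ≥ 158)`,
…, `(30, d ≥ 323)` (the first four, `p = 9 … 12`, are also the first-layer instances of `S3ShadowLayersRLS`).
Axioms: standard.
-/

namespace PercRepro

namespace Shadow

/-- The layer product is monotone in the ground size `n`. -/
theorem layerProd_mono (q : ℕ) (F : ℕ → ℕ) (k : ℕ) {n n' : ℕ} (h : n ≤ n') :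
    layerProd n q F k ≤ layerProd n' q F k := by
  induction k with
  | zero => simp [layerProd]
  | succ k ih =>
    simp only [layerProd]
    have h1 : (((n - F (q + k) : ℕ) : ℚ) / ((q + k : ℚ) + 1)) ≤ (((n' - F (q + k) : ℕ) : ℚ) / ((q + k : ℚ) + 1)) := by
      apply div_le_div_of_nonneg_right _ (by positivity)
      exact_mod_cast Nat.sub_le_sub_right h _
    have h0 : (0 : ℚ) ≤ (((n - F (q + k) : ℕ) : ℚ) / ((q + k : ℚ) + 1)) := by positivity
    exact mul_le_mul ih h1 h0 (layerProd_nonneg _ _ _ _)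

end Shadow

namespace ThmN

open Shadow

variable {α : Type}

/-- **The layers from one ground size**: if `Φ(p, 6) ≤ Σ_{1 ≤ k < p − 6} L_k(n₀)` and `|E| ≥ n₀`, the `e`-free core
satisfies C-025 at `(p, 6)`. -/
theorem rls_six_of_layers_core_of_le [DecidableEq α] (M : Matroid α) [M.Finite] (p n₀ : ℕ)
    (hfree : ∀ e ∈ M.E, ∃ A ⊆ M.E \ {e}, e ∉ M.closure A ∧ e ∉ M.closure ((M.E \ {e}) \ A))
    (hsum : phiK p 6 ≤ ∑ k ∈ Finset.Ico 1 (p - 6), layerProd n₀ 6 (fun u => 44 * 2 ^ (u - 6) - 1) k)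
    (hn : n₀ ≤ M.E.ncard) : RLS M p 6 := by
  apply rls_six_of_layers_core M p hfree
  refine hsum.trans (Finset.sum_le_sum (fun k _ => ?_))
  exact layerProd_mono 6 _ k hn

/-- `Φ(13, 6) = 338/21`. -/
theorem phiK_13_six : phiK 13 6 = 338 / 21 := by
  unfold phiK
  rw [show Finset.Ioo 6 13 = {7, 8, 9, 10, 11, 12} from by decide]
  norm_num [Nat.choose]

/-- **The cell `(13, 6)` on the `e`-free core at every `|E| ≥ 97`** (corank `≥ 84`). -/
theorem rls_13_six_of_core [DecidableEq α] (M : Matroid α) [M.Finite]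
    (hfree : ∀ e ∈ M.E, ∃ A ⊆ M.E \ {e}, e ∉ M.closure A ∧ e ∉ M.closure ((M.E \ {e}) \ A))
    (hn : 97 ≤ M.E.ncard) : RLS M 13 6 := by
  refine rls_six_of_layers_core_of_le M 13 97 hfree ?_ hn
  rw [phiK_13_six]
  norm_num [Finset.sum_Ico_eq_sum_range, Finset.sum_range_succ, layerProd]

/-- `Φ(14, 6) = 359/15`. -/
theorem phiK_14_six : phiK 14 6 = 359 / 15 := by
  unfold phiK
  rw [show Finset.Ioo 6 14 = {7, 8, 9, 10, 11, 12, 13} from by decide]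
  norm_num [Nat.choose]

/-- **The cell `(14, 6)` on the `e`-free core at every `|E| ≥ 102`** (corank `≥ 88`). -/
theorem rls_14_six_of_core [DecidableEq α] (M : Matroid α) [M.Finite]
    (hfree : ∀ e ∈ M.E, ∃ A ⊆ M.E \ {e}, e ∉ M.closure A ∧ e ∉ M.closure ((M.E \ {e}) \ A))
    (hn : 102 ≤ M.E.ncard) : RLS M 14 6 := by
  refine rls_six_of_layers_core_of_le M 14 102 hfree ?_ hn
  rw [phiK_14_six]
  norm_num [Finset.sum_Ico_eq_sum_range, Finset.sum_range_succ, layerProd]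

/-- `Φ(15, 6) = 748/21`. -/
theorem phiK_15_six : phiK 15 6 = 748 / 21 := by
  unfold phiK
  rw [show Finset.Ioo 6 15 = {7, 8, 9, 10, 11, 12, 13, 14} from by decide]
  norm_num [Nat.choose]

/-- **The cell `(15, 6)` on the `e`-free core at every `|E| ≥ 110`** (corank `≥ 95`). -/
theorem rls_15_six_of_core [DecidableEq α] (M : Matroid α) [M.Finite]
    (hfree : ∀ e ∈ M.E, ∃ A ⊆ M.E \ {e}, e ∉ M.closure A ∧ e ∉ M.closure ((M.E \ {e}) \ A))
    (hn : 110 ≤ M.E.ncard) : RLS M 15 6 := by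
  refine rls_six_of_layers_core_of_le M 15 110 hfree ?_ hn
  rw [phiK_15_six]
  norm_num [Finset.sum_Ico_eq_sum_range, Finset.sum_range_succ, layerProd]

/-- `Φ(16, 6) = 12304/231`. -/
theorem phiK_16_six : phiK 16 6 = 12304 / 231 := by
  unfold phiK
  rw [show Finset.Ioo 6 16 = {7, 8, 9, 10, 11, 12, 13, 14, 15} from by decide]
  norm_num [Nat.choose]

/-- **The cell `(16, 6)` on the `e`-free core at every `|E| ≥ 119`** (corank `≥ 103`). -/
theorem rls_16_six_of_core [DecidableEq α] (M : Matroid α) [M.Finite]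
    (hfree : ∀ e ∈ M.E, ∃ A ⊆ M.E \ {e}, e ∉ M.closure A ∧ e ∉ M.closure ((M.E \ {e}) \ A))
    (hn : 119 ≤ M.E.ncard) : RLS M 16 6 := by
  refine rls_six_of_layers_core_of_le M 16 119 hfree ?_ hn
  rw [phiK_16_six]
  norm_num [Finset.sum_Ico_eq_sum_range, Finset.sum_range_succ, layerProd]

/-- `Φ(17, 6) = 18530/231`. -/
theorem phiK_17_six : phiK 17 6 = 18530 / 231 := by
  unfold phiK
  rw [show Finset.Ioo 6 17 = {7, 8, 9, 10, 11, 12, 13, 14, 15, 16} from by decide]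
  norm_num [Nat.choose]

/-- **The cell `(17, 6)` on the `e`-free core at every `|E| ≥ 131`** (corank `≥ 114`). -/
theorem rls_17_six_of_core [DecidableEq α] (M : Matroid α) [M.Finite]
    (hfree : ∀ e ∈ M.E, ∃ A ⊆ M.E \ {e}, e ∉ M.closure A ∧ e ∉ M.closure ((M.E \ {e}) \ A))
    (hn : 131 ≤ M.E.ncard) : RLS M 17 6 := by
  refine rls_six_of_layers_core_of_le M 17 131 hfree ?_ hn
  rw [phiK_17_six]
  norm_num [Finset.sum_Ico_eq_sum_range, Finset.sum_range_succ, layerProd]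

/-- `Φ(18, 6) = 18761/154`. -/
theorem phiK_18_six : phiK 18 6 = 18761 / 154 := by
  unfold phiK
  rw [show Finset.Ioo 6 18 = {7, 8, 9, 10, 11, 12, 13, 14, 15, 16, 17} from by decide]
  norm_num [Nat.choose]

/-- **The cell `(18, 6)` on the `e`-free core at every `|E| ≥ 146`** (corank `≥ 128`). -/
theorem rls_18_six_of_core [DecidableEq α] (M : Matroid α) [M.Finite]
    (hfree : ∀ e ∈ M.E, ∃ A ⊆ M.E \ {e}, e ∉ M.closure A ∧ e ∉ M.closure ((M.E \ {e}) \ A))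
    (hn : 146 ≤ M.E.ncard) : RLS M 18 6 := by
  refine rls_six_of_layers_core_of_le M 18 146 hfree ?_ hn
  rw [phiK_18_six]
  norm_num [Finset.sum_Ico_eq_sum_range, Finset.sum_range_succ, layerProd]

/-- `Φ(19, 6) = 71877/385`. -/
theorem phiK_19_six : phiK 19 6 = 71877 / 385 := by
  unfold phiK
  rw [show Finset.Ioo 6 19 = {7, 8, 9, 10, 11, 12, 13, 14, 15, 16, 17, 18} from by decide]
  norm_num [Nat.choose]

/-- **The cell `(19, 6)` on the `e`-free core at every `|E| ≥ 165`** (corank `≥ 146`). -/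
theorem rls_19_six_of_core [DecidableEq α] (M : Matroid α) [M.Finite]
    (hfree : ∀ e ∈ M.E, ∃ A ⊆ M.E \ {e}, e ∉ M.closure A ∧ e ∉ M.closure ((M.E \ {e}) \ A))
    (hn : 165 ≤ M.E.ncard) : RLS M 19 6 := by
  refine rls_six_of_layers_core_of_le M 19 165 hfree ?_ hn
  rw [phiK_19_six]
  norm_num [Finset.sum_Ico_eq_sum_range, Finset.sum_range_succ, layerProd]

/-- `Φ(20, 6) = 289048/1001`. -/
theorem phiK_20_six : phiK 20 6 = 289048 / 1001 := by
  unfold phiK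
  rw [show Finset.Ioo 6 20 = {7, 8, 9, 10, 11, 12, 13, 14, 15, 16, 17, 18, 19} from by decide]
  norm_num [Nat.choose]

/-- **The cell `(20, 6)` on the `e`-free core at every `|E| ≥ 178`** (corank `≥ 158`). -/
theorem rls_20_six_of_core [DecidableEq α] (M : Matroid α) [M.Finite]
    (hfree : ∀ e ∈ M.E, ∃ A ⊆ M.E \ {e}, e ∉ M.closure A ∧ e ∉ M.closure ((M.E \ {e}) \ A))
    (hn : 178 ≤ M.E.ncard) : RLS M 20 6 := by
  refine rls_six_of_layers_core_of_le M 20 178 hfree ?_ hn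
  rw [phiK_20_six]
  norm_num [Finset.sum_Ico_eq_sum_range, Finset.sum_range_succ, layerProd]

/-- `Φ(21, 6) = 193366/429`. -/
theorem phiK_21_six : phiK 21 6 = 193366 / 429 := by
  unfold phiK
  rw [show Finset.Ioo 6 21 = {7, 8, 9, 10, 11, 12, 13, 14, 15, 16, 17, 18, 19, 20} from by decide]
  norm_num [Nat.choose]

/-- **The cell `(21, 6)` on the `e`-free core at every `|E| ≥ 183`** (corank `≥ 162`). -/
theorem rls_21_six_of_core [DecidableEq α] (M : Matroid α) [M.Finite]
    (hfree : ∀ e ∈ M.E, ∃ A ⊆ M.E \ {e}, e ∉ M.closure A ∧ e ∉ M.closure ((M.E \ {e}) \ A))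
    (hn : 183 ≤ M.E.ncard) : RLS M 21 6 := by
  refine rls_six_of_layers_core_of_le M 21 183 hfree ?_ hn
  rw [phiK_21_six]
  norm_num [Finset.sum_Ico_eq_sum_range, Finset.sum_range_succ, layerProd]

/-- `Φ(22, 6) = 27685/39`. -/
theorem phiK_22_six : phiK 22 6 = 27685 / 39 := by
  unfold phiK
  rw [show Finset.Ioo 6 22 = {7, 8, 9, 10, 11, 12, 13, 14, 15, 16, 17, 18, 19, 20, 21} from by decide]
  norm_num [Nat.choose]

/-- **The cell `(22, 6)` on the `e`-free core at every `|E| ≥ 190`** (corank `≥ 168`). -/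
theorem rls_22_six_of_core [DecidableEq α] (M : Matroid α) [M.Finite]
    (hfree : ∀ e ∈ M.E, ∃ A ⊆ M.E \ {e}, e ∉ M.closure A ∧ e ∉ M.closure ((M.E \ {e}) \ A))
    (hn : 190 ≤ M.E.ncard) : RLS M 22 6 := by
  refine rls_six_of_layers_core_of_le M 22 190 hfree ?_ hn
  rw [phiK_22_six]
  norm_num [Finset.sum_Ico_eq_sum_range, Finset.sum_range_succ, layerProd]

/-- `Φ(23, 6) = 43976/39`. -/
theorem phiK_23_six : phiK 23 6 = 43976 / 39 := by
  unfold phiK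
  rw [show Finset.Ioo 6 23 = {7, 8, 9, 10, 11, 12, 13, 14, 15, 16, 17, 18, 19, 20, 21, 22} from by decide]
  norm_num [Nat.choose]

/-- **The cell `(23, 6)` on the `e`-free core at every `|E| ≥ 199`** (corank `≥ 176`). -/
theorem rls_23_six_of_core [DecidableEq α] (M : Matroid α) [M.Finite]
    (hfree : ∀ e ∈ M.E, ∃ A ⊆ M.E \ {e}, e ∉ M.closure A ∧ e ∉ M.closure ((M.E \ {e}) \ A))
    (hn : 199 ≤ M.E.ncard) : RLS M 23 6 := by
  refine rls_six_of_layers_core_of_le M 23 199 hfree ?_ hn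
  rw [phiK_23_six]
  norm_num [Finset.sum_Ico_eq_sum_range, Finset.sum_range_succ, layerProd]

/-- `Φ(24, 6) = 70424/39`. -/
theorem phiK_24_six : phiK 24 6 = 70424 / 39 := by
  unfold phiK
  rw [show Finset.Ioo 6 24 = {7, 8, 9, 10, 11, 12, 13, 14, 15, 16, 17, 18, 19, 20, 21, 22, 23} from by decide]
  norm_num [Nat.choose]

/-- **The cell `(24, 6)` on the `e`-free core at every `|E| ≥ 210`** (corank `≥ 186`). -/
theorem rls_24_six_of_core [DecidableEq α] (M : Matroid α) [M.Finite]
    (hfree : ∀ e ∈ M.E, ∃ A ⊆ M.E \ {e}, e ∉ M.closure A ∧ e ∉ M.closure ((M.E \ {e}) \ A))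
    (hn : 210 ≤ M.E.ncard) : RLS M 24 6 := by
  refine rls_six_of_layers_core_of_le M 24 210 hfree ?_ hn
  rw [phiK_24_six]
  norm_num [Finset.sum_Ico_eq_sum_range, Finset.sum_range_succ, layerProd]

/-- `Φ(25, 6) = 113650/39`. -/
theorem phiK_25_six : phiK 25 6 = 113650 / 39 := by
  unfold phiK
  rw [show Finset.Ioo 6 25 = {7, 8, 9, 10, 11, 12, 13, 14, 15, 16, 17, 18, 19, 20, 21, 22, 23, 24} from by decide]
  norm_num [Nat.choose]

/-- **The cell `(25, 6)` on the `e`-free core at every `|E| ≥ 225`** (corank `≥ 200`). -/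
theorem rls_25_six_of_core [DecidableEq α] (M : Matroid α) [M.Finite]
    (hfree : ∀ e ∈ M.E, ∃ A ⊆ M.E \ {e}, e ∉ M.closure A ∧ e ∉ M.closure ((M.E \ {e}) \ A))
    (hn : 225 ≤ M.E.ncard) : RLS M 25 6 := by
  refine rls_six_of_layers_core_of_le M 25 225 hfree ?_ hn
  rw [phiK_25_six]
  norm_num [Finset.sum_Ico_eq_sum_range, Finset.sum_range_succ, layerProd]

/-- `Φ(26, 6) = 113689/24`. -/
theorem phiK_26_six : phiK 26 6 = 113689 / 24 := by
  unfold phiK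
  rw [show Finset.Ioo 6 26 = {7, 8, 9, 10, 11, 12, 13, 14, 15, 16, 17, 18, 19, 20, 21, 22, 23, 24, 25} from by decide]
  norm_num [Nat.choose]

/-- **The cell `(26, 6)` on the `e`-free core at every `|E| ≥ 243`** (corank `≥ 217`). -/
theorem rls_26_six_of_core [DecidableEq α] (M : Matroid α) [M.Finite]
    (hfree : ∀ e ∈ M.E, ∃ A ⊆ M.E \ {e}, e ∉ M.closure A ∧ e ∉ M.closure ((M.E \ {e}) \ A))
    (hn : 243 ≤ M.E.ncard) : RLS M 26 6 := by
  refine rls_six_of_layers_core_of_le M 26 243 hfree ?_ hn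
  rw [phiK_26_six]
  norm_num [Finset.sum_Ico_eq_sum_range, Finset.sum_range_succ, layerProd]

/-- `Φ(27, 6) = 341139/44`. -/
theorem phiK_27_six : phiK 27 6 = 341139 / 44 := by
  unfold phiK
  rw [show Finset.Ioo 6 27 = {7, 8, 9, 10, 11, 12, 13, 14, 15, 16, 17, 18, 19, 20, 21, 22, 23, 24, 25, 26} from by decide]
  norm_num [Nat.choose]

/-- **The cell `(27, 6)` on the `e`-free core at every `|E| ≥ 265`** (corank `≥ 238`). -/
theorem rls_27_six_of_core [DecidableEq α] (M : Matroid α) [M.Finite]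
    (hfree : ∀ e ∈ M.E, ∃ A ⊆ M.E \ {e}, e ∉ M.closure A ∧ e ∉ M.closure ((M.E \ {e}) \ A))
    (hn : 265 ≤ M.E.ncard) : RLS M 27 6 := by
  refine rls_six_of_layers_core_of_le M 27 265 hfree ?_ hn
  rw [phiK_27_six]
  norm_num [Finset.sum_Ico_eq_sum_range, Finset.sum_range_succ, layerProd]

/-- `Φ(28, 6) = 2388281/187`. -/
theorem phiK_28_six : phiK 28 6 = 2388281 / 187 := by
  unfold phiK
  rw [show Finset.Ioo 6 28 = {7, 8, 9, 10, 11, 12, 13, 14, 15, 16, 17, 18, 19, 20, 21, 22, 23, 24, 25, 26, 27} from by decide]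
  norm_num [Nat.choose]

/-- **The cell `(28, 6)` on the `e`-free core at every `|E| ≥ 292`** (corank `≥ 264`). -/
theorem rls_28_six_of_core [DecidableEq α] (M : Matroid α) [M.Finite]
    (hfree : ∀ e ∈ M.E, ∃ A ⊆ M.E \ {e}, e ∉ M.closure A ∧ e ∉ M.closure ((M.E \ {e}) \ A))
    (hn : 292 ≤ M.E.ncard) : RLS M 28 6 := by
  refine rls_six_of_layers_core_of_le M 28 292 hfree ?_ hn
  rw [phiK_28_six]
  norm_num [Finset.sum_Ico_eq_sum_range, Finset.sum_range_succ, layerProd]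

/-- `Φ(29, 6) = 138531144/6545`. -/
theorem phiK_29_six : phiK 29 6 = 138531144 / 6545 := by
  unfold phiK
  rw [show Finset.Ioo 6 29 = {7, 8, 9, 10, 11, 12, 13, 14, 15, 16, 17, 18, 19, 20, 21, 22, 23, 24, 25, 26, 27, 28} from by decide]
  norm_num [Nat.choose]

/-- **The cell `(29, 6)` on the `e`-free core at every `|E| ≥ 325`** (corank `≥ 296`). -/
theorem rls_29_six_of_core [DecidableEq α] (M : Matroid α) [M.Finite]
    (hfree : ∀ e ∈ M.E, ∃ A ⊆ M.E \ {e}, e ∉ M.closure A ∧ e ∉ M.closure ((M.E \ {e}) \ A))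
    (hn : 325 ≤ M.E.ncard) : RLS M 29 6 := by
  refine rls_six_of_layers_core_of_le M 29 325 hfree ?_ hn
  rw [phiK_29_six]
  norm_num [Finset.sum_Ico_eq_sum_range, Finset.sum_range_succ, layerProd]

/-- `Φ(30, 6) = 138537689/3927`. -/
theorem phiK_30_six : phiK 30 6 = 138537689 / 3927 := by
  unfold phiK
  rw [show Finset.Ioo 6 30 = {7, 8, 9, 10, 11, 12, 13, 14, 15, 16, 17, 18, 19, 20, 21, 22, 23, 24, 25, 26, 27, 28, 29} from by decide]
  norm_num [Nat.choose]

/-- **The cell `(30, 6)` on the `e`-free core at every `|E| ≥ 353`** (corank `≥ 323`). -/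
theorem rls_30_six_of_core [DecidableEq α] (M : Matroid α) [M.Finite]
    (hfree : ∀ e ∈ M.E, ∃ A ⊆ M.E \ {e}, e ∉ M.closure A ∧ e ∉ M.closure ((M.E \ {e}) \ A))
    (hn : 353 ≤ M.E.ncard) : RLS M 30 6 := by
  refine rls_six_of_layers_core_of_le M 30 353 hfree ?_ hn
  rw [phiK_30_six]
  norm_num [Finset.sum_Ico_eq_sum_range, Finset.sum_range_succ, layerProd]

end ThmN

end PercRepro
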